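import Mathlib
import Literature.Analysis.FluidPDE.Tao2016AveragedNS.ShiftSetCascadeFlows
import Summits.NavierStokesRegularity.NavierStokesRegularity.Theorems.TaoLadderRungTwoFlatCertificateGlueLohnerRowRemOn
import Summits.NavierStokesRegularity.NavierStokesRegularity.Theorems.TaoLadderRungTwoFlatCertificateGlueLohnerVectorOn
import HarnessLib

/-!
# Certificate glue on a shift set `𝕊`, XIX-i: THE VECTOR-REMAINDER LOHNER STEP WITH PER-ROW REMAINDER FACTORS — glue XIX-h `stepCert_of_plohner_mv`
  with the Taylor remainder from the node point taken PER ROW (glue XVIII-d `lohner_land_mvr`: `b_c·m'² h (b m' h)^p/(1 − b m' h)` with the row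
  constants `b_c` of the window field, instead of the uniform `m'(b m' h)^{p+1}/(1 − b m' h)`) (helper for items stmt-NavierStokesRegularity-22987
  `FlatGapCertificatesV2` (crux K_A♭ of route TaoLadderRungTwoFlat) and stmt-24295 K_A₂(64); cell harvest/h2-tao-ladder, p1 g16; theory-1 F-24 /
  layout V «β_c·S_Q»: the per-row factor is load-bearing for the recurrent branch)

`stepCert_of_plohner_mvr`: data and conclusion as in glue XIX-h, plus the row-constant hypothesis `hBrow` (`|PQcN(y,z)_c| ≤ b_c N_y N_z`, glue XXV-h
`bRowSum`) and the per-component E-recursion `dP_c + κ_c + NVE_c + b_c·(m_C+ρ_s)² h (b(m_C+ρ_s)h)^p/(1 − b(m_C+ρ_s)h) ≤ E'_c`.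

HONEST FRAMING: Tao-type MODEL lattices (Tao 2016 §4/§6 vocabulary, shift-set parametrised); every clause is a HYPOTHESIS — nothing is computed
or certified here, no stub is closed, nothing about the Navier–Stokes equations.
-/

noncomputable section

-- the sub-problem namespace repeats the summit name by design (D-0017)
set_option linter.dupNamespace false

namespace Summit.NavierStokesRegularity.NavierStokesRegularity.Theorems

open Set Filter Topology Literature.Analysis.FluidPDE Literature.Analysis.FluidPDE.TaoCascade
open Summit.NavierStokesRegularity.NavierStokesRegularity.Theorems.TaylorModelReadout

namespace CertificateGlueOn

variable {m : ℕ} {Kb Ka : ℤ} {ω : Fin m → ℤ → ℝ}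
  {𝕊 : Finset (ℤ × ℤ × ℤ)} {ε₀ : ℝ} {α : Fin m → Fin m → Fin m → ℤ × ℤ × ℤ → ℝ} {Eb Et : ℝ}

/-! ### The step certificate -/

/-- **`StepCert` FROM A VECTOR-REMAINDER MEAN-VALUE LOHNER STEP WITH PER-ROW REMAINDER FACTORS, THE PRODUCT-FORM TUBE AND A BOX
REGION** (see the module docstring). Data: centre `x` (`|x| ≤ m_C`), frame `C` with per-row radii `ρ_c` on the `r`-box, remainder vector
`E` (`ρ_c + E_c ≤ ρ_s`), clock `h = t(j+1) − t(j)` with the scalar majorant guard; landing data `x', Cn, T, r', E₁` with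
the clauses of `lohner_land_mvr` (unit S1-weights, row constants `brow`); tube data `V, G`; box region `[glo, ghi] ⊇ ProdTube ⊕ A'·ω` carrying
the Lipschitz constant `K` and the input defect `δ`, allowance `gronwallBound 0 K δ h ≤ A < A'`.
[cite: Zgliczynski2002C1Lohner, §3–4 (Lohner-type parallelepiped frames and the C¹/variational enclosure); cell certificate format, Lohner step, vector remainder] -/
theorem stepCert_of_plohner_mvr (hKb : 0 ≤ Kb) (hKa : 1 ≤ Ka) (hε : 0 < 1 + ε₀) (hω : ∀ i k, 0 < ω i k)
    {M : ℤ → ℝ} {t : ℕ → ℝ} {Node Hull : ℕ → (Fin m → ℤ → ℝ) → Prop} {j p : ℕ}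
    {b mC ρs K δ A A' : ℝ} {x x' : Fin (m * winLen Kb Ka) → ℝ}
    {C Cn T : Matrix (Fin (m * winLen Kb Ka)) (Fin (m * winLen Kb Ka)) ℝ}
    {r r' ρ E E₁ dP κ NVE V G brow : Fin (m * winLen Kb Ka) → ℝ} {glo ghi : Fin m → ℤ → ℝ}
    (hb : 0 ≤ b) (hmC : 0 ≤ mC) (hρs : 0 ≤ ρs) (hK : 0 ≤ K) (hδ : 0 ≤ δ) (hAA' : A < A')
    (hh : 0 ≤ t (j + 1) - t j) (hguard : b * (mC + ρs) * (t (j + 1) - t j) < 1)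
    (hB : ∀ i k, -Kb ≤ k → k ≤ Ka →
      ∑ i₁ : Fin m, ∑ i₂ : Fin m, ∑ μ ∈ 𝕊,
        |α i₁ i₂ i μ| * (1 + ε₀) ^ ((5 : ℝ) * (k - μ.2.2) / 2) *
          (pwExt Kb Ka ω i₁ (k - μ.2.2 + μ.1) * pwExt Kb Ka ω i₂ (k - μ.2.2 + μ.2.1)) ≤ b * ω i k)
    (hBrow : ∀ (y z : Fin (m * winLen Kb Ka) → ℝ) (Ny Nz : ℝ), 0 ≤ Ny → 0 ≤ Nz → (∀ d, |y d| ≤ Ny) → (∀ d, |z d| ≤ Nz) →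
      ∀ c, |PQcN 𝕊 ε₀ α Kb Ka ω y z c| ≤ brow c * Ny * Nz)
    (hx : ∀ c, |x c| ≤ mC)
    (hC : ∀ ξ : Fin (m * winLen Kb Ka) → ℝ, (∀ c, |ξ c| ≤ r c) → ∀ c, |C.mulVec ξ c| ≤ ρ c)
    (hρE : ∀ c, ρ c + E c ≤ ρs)
    -- landing clauses (glue XVIII-d, unit weights)
    (hdP : ∀ c, |TPoly (PQcN 𝕊 ε₀ α Kb Ka ω) p x (t (j + 1) - t j) c - x' c| ≤ dP c)
    (hκ : ∀ z : Fin (m * winLen Kb Ka) → ℝ, (∀ d, |z d - x d| ≤ ρ d + E d) →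
      ∀ ξ : Fin (m * winLen Kb Ka) → ℝ, (∀ c, |ξ c| ≤ r c) →
      ∀ c, |(VPoly (PQcN 𝕊 ε₀ α Kb Ka ω) p z (C.mulVec ξ) (t (j + 1) - t j) - Cn.mulVec (T.mulVec ξ)) c| ≤ κ c)
    (hNVE : ∀ z : Fin (m * winLen Kb Ka) → ℝ, (∀ d, |z d - x d| ≤ ρ d + E d) →
      ∀ e : Fin (m * winLen Kb Ka) → ℝ, (∀ c, |e c| ≤ E c) →
      ∀ c, |VPoly (PQcN 𝕊 ε₀ α Kb Ka ω) p z e (t (j + 1) - t j) c| ≤ NVE c)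
    (hframe : ∀ ξ : Fin (m * winLen Kb Ka) → ℝ, (∀ c, |ξ c| ≤ r c) → ∀ c, |T.mulVec ξ c| ≤ r' c)
    (hE₁ : ∀ c, dP c + κ c + NVE c + brow c * ((mC + ρs) ^ 2 * (t (j + 1) - t j) * (b * (mC + ρs) * (t (j + 1) - t j)) ^ p /
      (1 - b * (mC + ρs) * (t (j + 1) - t j))) ≤ E₁ c)
    -- the product-form tube
    (hV : ∀ y : Fin (m * winLen Kb Ka) → ℝ, (∀ d, |y d| ≤ G d) → ∀ c, |PQcN 𝕊 ε₀ α Kb Ka ω y y c| ≤ V c)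
    (hV0 : ∀ c, 0 ≤ V c) (hG : ∀ c, |x c| + (ρ c + E c) + (t (j + 1) - t j) * V c < G c)
    -- the box region: contains every state within `A'·ω` of a state in the tube (at any `u ≤ h`)
    (hGbox : ∀ u ∈ Icc 0 (t (j + 1) - t j), ∀ q y : Fin m → ℤ → ℝ, ProdTube Kb Ka ω x ρ E V u q →
      (∀ i k, -Kb ≤ k → k ≤ Ka → |y i k - q i k| ≤ A' * ω i k) → InBoxOn Kb Ka glo ghi y)
    (hlip : PFieldLipOn 𝕊 ε₀ α Kb Ka ω glo ghi K) (hdef : PInputDefectOn 𝕊 ε₀ α Kb Ka Eb Et ω glo ghi δ)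
    (hA : gronwallBound 0 K δ (t (j + 1) - t j) ≤ A)
    (hN : ∀ y, Node j y → PInParaV Kb Ka ω x C r E y)
    (hH : ∀ u ∈ Icc 0 (t (j + 1) - t j), ∀ y q : Fin m → ℤ → ℝ, ProdTube Kb Ka ω x ρ E V u q →
      (∀ i k, -Kb ≤ k → k ≤ Ka → |y i k - q i k| ≤ A * ω i k) → Hull j y)
    (hN' : ∀ y, PInParaV Kb Ka ω x' Cn r' (fun c => E₁ c + A) y → Node (j + 1) y) :
    StepCert 𝕊 ε₀ α Kb Ka Eb Et M t Node Hull j := by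
  have hKK : 0 ≤ Ka + Kb + 1 := by omega
  set h := t (j + 1) - t j with hhdef
  set Q := PQcN 𝕊 ε₀ α Kb Ka ω with hQ
  have hBQ := pqcN_bound_of_table (𝕊 := 𝕊) (ε₀ := ε₀) (α := α) hε hω hKK hB
  have hQl : ∀ u, IsLinearMap ℝ (Q u) := isLinearMap_PQcN_right
  have hQr : ∀ v, IsLinearMap ℝ (fun u => Q u v) := isLinearMap_PQcN_left
  have hmρ : 0 ≤ mC + ρs := add_nonneg hmC hρs
  -- the exact flow from every node state: start, window equations, product tube, vector-remainder landing
  have hflow : ∀ z : Fin m → ℤ → ℝ, PInParaV Kb Ka ω x C r E z → ∃ ψ : Fin m → ℤ → ℝ → ℝ,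
      (∀ i k, -Kb ≤ k → k ≤ Ka → ψ i k 0 = z i k) ∧
      (∀ i k, -Kb ≤ k → k ≤ Ka → ∀ u ∈ Icc 0 h,
        HasDerivWithinAt (ψ i k) (truncField 𝕊 ε₀ α Kb Ka (slice ψ u) i k) (Icc 0 h) u) ∧
      (∀ u ∈ Icc 0 h, ProdTube Kb Ka ω x ρ E V u (slice ψ u)) ∧
      PInParaV Kb Ka ω x' Cn r' E₁ (slice ψ h) := by
    intro z hz
    obtain ⟨ξ, e, hξ, he, hze⟩ := hz
    set v := C.mulVec ξ + e with hvdef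
    have hv : ∀ c, |v c| ≤ ρ c + E c := fun c => (abs_add_le _ _).trans (add_le_add (hC ξ hξ c) (he c))
    have hvs : ∀ c, |v c| ≤ ρs := fun c => (hv c).trans (hρE c)
    -- existence on `[0,h]` by the scalar majorant (glue XVIII)
    obtain ⟨ψ, hψ0, hψd, -⟩ := lohner_exists hQl hQr hb hBQ hh hmC hρs hx hguard v hvs
    -- the product-form tube (glue XVIII-c)
    have hu₀ : ∀ c, |ψ 0 c| ≤ |x c| + (ρ c + E c) := fun c => by
      rw [hψ0, Pi.add_apply]; exact (abs_add_le _ _).trans (add_le_add le_rfl (hv c))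
    have htube := prodTube_bound (Q := Q) hh hV hV0 hψd hu₀ hG
    -- the landing (glue XVIII-d with unit weights, `m' = mC + ρs`)
    have hBQ1 : ∀ (u w : Fin (m * winLen Kb Ka) → ℝ) (Nu Nv : ℝ), 0 ≤ Nu → 0 ≤ Nv →
        (∀ c, |u c| ≤ Nu * (fun _ => (1 : ℝ)) c) → (∀ c, |w c| ≤ Nv * (fun _ => (1 : ℝ)) c) →
        ∀ c, |Q u w c| ≤ b * Nu * Nv * (fun _ => (1 : ℝ)) c := hBQ
    have hBrow1 : ∀ (u w : Fin (m * winLen Kb Ka) → ℝ) (Nu Nv : ℝ), 0 ≤ Nu → 0 ≤ Nv →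
        (∀ c, |u c| ≤ Nu * (fun _ => (1 : ℝ)) c) → (∀ c, |w c| ≤ Nv * (fun _ => (1 : ℝ)) c) →
        ∀ c, |Q u w c| ≤ brow c * Nu * Nv * (fun _ => (1 : ℝ)) c := fun u w Nu Nv hNu hNv hu hw c => by
      simpa using hBrow u w Nu Nv hNu hNv (fun d => by simpa using hu d) (fun d => by simpa using hw d) c
    have hland := lohner_land_mvr (Q := Q) (w := fun _ => (1 : ℝ)) hQl hQr (fun _ => one_pos) hb hBQ1 hBrow1
      (p := p) (h := h) (m' := mC + ρs) (x := x) (x' := x') (C := C) (Cn := Cn) (T := T) (r := r) (r' := r')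
      (ρ := ρ) (E := E) (E₁ := E₁) (dP := dP) (κ := κ) (NVE := NVE) hh hmρ
      (fun ξ' e' hξ' he' c => by
        rw [mul_one, Pi.add_apply]
        exact (abs_add_le _ _).trans (add_le_add (hx c)
          (((abs_add_le _ _).trans (add_le_add (hC ξ' hξ' c) (he' c))).trans (hρE c))))
      hguard hC hdP hκ hNVE hframe (fun c => by rw [mul_one]; exact hE₁ c) ξ e hξ he ψ hψ0 hψd
    -- the cascade family built from `ψ`
    have hstart : (ψ 0) ∘ finProdFinEquiv = pwcoord Kb Ka ω z := by
      rw [hψ0, ← hze]; funext c; simp [pxcoord]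
    have hsl : ∀ u, slice (fun i k u => pwstate Kb Ka ω ((ψ u) ∘ finProdFinEquiv) i k) u =
        pwstate Kb Ka ω ((ψ u) ∘ finProdFinEquiv) := fun u => by funext i' k'; rfl
    have hxc : ∀ u, pxcoord Kb Ka ω (pwstate Kb Ka ω ((ψ u) ∘ finProdFinEquiv)) = ψ u := by
      intro u; funext d
      simp only [pxcoord, pwcoord_pwstate hω hKK, Function.comp_apply, Equiv.apply_symm_apply]
    refine ⟨fun i k u => pwstate Kb Ka ω ((ψ u) ∘ finProdFinEquiv) i k, fun i k hk1 hk2 => ?_,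
      fun i k hk1 hk2 u hu => ?_, fun u hu c => ?_, ?_⟩
    · show pwstate Kb Ka ω ((ψ 0) ∘ finProdFinEquiv) i k = z i k
      rw [hstart, pwstate_pwcoord hω z i hk1 hk2]
    · -- the window equation (as in glue XIX-c)
      have hlt : (k + Kb).toNat < winLen Kb Ka := by
        unfold winLen; rw [Int.toNat_lt_toNat (by omega)]; omega
      set c : Fin (winLen Kb Ka) := ⟨(k + Kb).toNat, hlt⟩ with hc
      have hsh : shellAt Kb c = k := by
        simp only [shellAt, hc]; rw [Int.toNat_of_nonneg (by omega)]; ring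
      have hfun : (fun u => pwstate Kb Ka ω ((ψ u) ∘ finProdFinEquiv) i k) =
          fun u => ω i k * ψ u (finProdFinEquiv (i, c)) := by
        funext u
        have := pwstate_on (ω := ω) ((ψ u) ∘ finProdFinEquiv) hKK i c
        rw [hsh] at this
        simpa using this
      dsimp only
      rw [hfun]
      have hd := (hasDerivWithinAt_pi.1 (hψd u hu) (finProdFinEquiv (i, c))).const_mul (ω i k)
      refine hd.congr_deriv ?_
      rw [hsl u, truncField_eq_biFieldOn]
      have hQapp : Q (ψ u) (ψ u) (finProdFinEquiv (i, c)) =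
          biFieldOn 𝕊 ε₀ α Kb Ka (pwstate Kb Ka ω ((ψ u) ∘ finProdFinEquiv))
            (pwstate Kb Ka ω ((ψ u) ∘ finProdFinEquiv)) i k / ω i k := by
        simp only [hQ, PQcN, PQc, Equiv.symm_apply_apply, pwcoord]
        rw [hsh]
      rw [hQapp]
      field_simp [(hω i k).ne']
    · -- the product-form tube
      rw [hsl u, hxc u]
      have h1 := (htube u hu c).2
      rw [hψ0] at h1
      have hvc := hv c
      have : |ψ u c - x c| ≤ |ψ u c - (x + v) c| + |v c| := by
        have := abs_sub_le (ψ u c) ((x + v) c) (x c)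
        simpa [Pi.add_apply] using this
      linarith
    · rw [hsl h]
      exact pinParaV_of_coords hω hKK hland
  exact stepCert_of_flowTube_local (Start := PInParaV Kb Ka ω x C r E) (Land := PInParaV Kb Ka ω x' Cn r' E₁)
    (Tube := fun u q => ProdTube Kb Ka ω x ρ E V u q)
    hKb hKa hω hK hδ hAA' hN (fun u hu q y hq hnear => hGbox u hu q y hq hnear) hlip hdef hflow hA
    (fun u hu y q hq hnear => hH u hu y q hq hnear) (fun y q hq hnear => hN' y (pinParaV_of_near hω hKK hq hnear))

end CertificateGlueOn

end Summit.NavierStokesRegularity.NavierStokesRegularity.Theorems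

end
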